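import Literature.AnabelianGeometry.EtaleTheta.Discharge.Sec5Lem59ivOfThetaSetting

/-!
# [EtTh] Lemma 5.9 (iv) — the cone node `EtTh:Lem5.9(iv)` RE-CLOSED at the §5 data OF THE SETTING with `A_⊙^bs := Ÿ̲̲`:
# the node's closer `envIsoBiTheta_of` with EVERY refuted-closure FACT binder supplied BY NAME (p. 332 / PDF p. 106)

S. Mochizuki, *The étale theta function and its Frobenioid-theoretic manifestations*, Publ. RIMS **45** (2009) [EtTh],
Lemma 5.9 (iv) p. 332 (PDF p. 106) [cite: MochizukiEtTh2009, Lem 5.9 (iv) p.332 (PDF p.106)]; Lemma 5.8 p. 331 (PDF p. 105);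
§5 pp. 330–331 (PDF pp. 104–105); Prop. 5.2 (iii) p. 324 (PDF p. 98).

abc-iut cell, layer L2, seat abc-iut-w6-d053 (gen 6); K4 / C-R33 RE-CLOSE of the cone node `EtTh:Lem5.9(iv)` (plan/CONE-BOARD row
«RE-CLOSE (vacuous binder: F-0518, F-0519, F-0520, F-0521, F-0533, F-0536, F-0542, F-0543, F-0738, F-1306, F-1307, F-2494)»;
abc-iut-c312-2 CONE-K4-RECLOSE.tsv v4 row 34).  PROOF-ONLY (0 definitions, 0 instances, 0 new `Prop` facts; nothing landed is
edited or restated): three compositions of LANDED theorems, read at abc-iut-L2-t4's junction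
`𝔉 := ofThetaSettingData μ hC hS h Q R K' constEmb … hinvc hinvp` over `BiKummerSetting.mkOfThetaSettingYdd C e μ hC hS tf hZ hP NH`
(the §5 data of a theta setting: `Π^tp_X̲̲ := C.Huu`, `A_⊙^bs := Ÿ̲̲`), `T := C.thetaEnvData μ hC hS` (abc-iut-L2-t8), `ι := id`,
`DK := dkOfConnectedTemperoidData … hconst hK` (the honest `K^×`-part, `= α.kummerOut hK` by `rfl`).

THE NODE'S CLOSER AND ITS BINDERS.  The closing theorem of record of `EtTh:Lem5.9(iv)` is abc-iut-L2-t11's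
`ThetaFrobenioid.envIsoBiTheta_of` (`Discharge/Sec5BiThetaIso.lean`): abc-iut-L2-t4's named statement `EnvIsoBiTheta h1 h3 hsec hcs h8 DK T ι`
("the natural inclusions `μ_N(B_N) ↪ E_N`, `Im(Π^tp_Y) ⊆ E_N` determine an isomorphism of topological groups `E^Π_N ⥲ Π^tp_Y[μ_N]`
which is an isomorphism of mod `N` bi-theta environments"), GIVEN the binders `H : Facts` (F-2494), `h1 : SectionsFactor` (F-0542),
`h3 : OuterActionLZ` (F-0539), `hsec : SgpCapSection` (F-0738), `hcs : SgpCupSection` (F-0543), `h8 : ConstantsEqNormalizer` (F-0536),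
`hY : IdentifiesPiY` (F-0533), `hYdd : IdentifiesPiYdd` (F-0519), `hχX : CyclotomicCharacterCompatX` (F-1306; `hχ := hχX.toY`, F-1307),
`hcompat : ThetaSectionCompat` (F-0521), `hK1 : ConstOutTransported` (F-0518), `hK2 : KummerOutReached` (F-0520) (and the field
`T.isCocycle`, F-0516, which is PART OF THE DATUM `T`).  The universal closures of these rows are refuted in the tree (K4); what survives
is their INSTANCE FORM at genuine carriers.  AT THE Ÿ̲̲-JUNCTION DATA every one of them is a THEOREM of the cell, BY NAME:
* F-2494 `Facts` ⟸ {`hconst`, `hD`}: abc-iut-L2-t4's `facts_ofThetaSettingYddData_of_constantsDictionary` (p440765; `hgc := hD.hgc`);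
  hence F-0542 / F-0738 / F-0543 / F-0536 as its projections (and F-0542 / F-0738 / F-0543 even with NO hypothesis beyond the data:
  this seat's gen-5 `sectionsFactor_ofThetaSettingYddData` p462478, `sgpCapSection_ofThetaSettingYddData` / `sgpCupSection_ofThetaSettingYddData`
  p461358; F-0536 ⟸ {`hconst`, `hgc`}: `constantsEqNormalizer_ofThetaSettingYddData` p461358);
* F-0539 `OuterActionLZ`: abc-iut-L2-t4's UNCONDITIONAL `outerActionLZ_of`;
* F-0533 / F-0519 at `ι := id`: abc-iut-L2-t4's `identifiesPiY_ofThetaSettingData` / `identifiesPiYdd_ofThetaSettingData'` (p440765);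
* F-1306 / F-1307 ⟸ `hD`: abc-iut-L2-t11's `ConstantsDictionary.cyclotomicCharacterCompatX` (p439828; junction form abc-iut-f-125 p437488,
  `Y`-form this seat's gen-5 p460460) — consumed INSIDE the chain below;
* F-0518 / F-0520 at `DK := kummerOut` ⟸ the ν-package of `hD`: abc-iut-L2-t11's `constOutTransported_birat` /
  `kummerOutReached_birat_of_continuous` discharged in `envIsoBiTheta_birat_of_galoisDictionary` → `envIsoBiTheta_kummerOut_ofSetting`
  (p437577) → `ConstantsDictionary.envIsoBiTheta_kummerOut` (p439828) — consumed INSIDE the chain;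
* F-0521: EITHER kept in its surviving instance form `hcompat` for a cocycle `η` of the collection (second theorem below), OR supplied by
  abc-iut-f-125 / abc-iut-f-116's SOLVED FORM `thetaSectionCompat_ofThetaSettingData_transport` for `η :=` the transported bi-Kummer
  difference cocycle, leaving the ONE Prop. 5.2 (iii) ORIGIN CLAUSE `hΘ` «that cocycle lies in `C.thetaCocycles hC μ`» (GAP G-L2t4-2,
  pin `θ := Θ̈`) (first theorem below; abc-iut-L2-t11 g4 `envIsoBiTheta_ofThetaSettingData_of_originClause`, p441744).

WHAT THIS FILE DISPLAYS (the K4 re-close, format of record abc-iut-w6-d039 / f-128 / w6-d058):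
* `envIsoBiTheta_ofThetaSettingYdd_of_originClause_canonical` — the node's closer RE-KEYED: `EnvIsoBiTheta` at the Ÿ̲̲-junction data with
  NO §5-law binder and NO `Facts` binder displayed (the five law arguments indexing `E^Π_N` SUPPLIED by `Facts` ⟸ {`hconst`, `hD`} and by
  `outerActionLZ_of`) — residual EXACTLY {junction data, `hconst` (Def. 3.6 (iii)), the ONE dictionary binder `hD` (Def. 3.6 (iii)/(iv):
  constants of `B_N` read in `ℚ̄_p`), a cyclotome reading `m`, the origin clause `hΘ`};
* `envIsoBiTheta_ofThetaSettingYdd_of_thetaSectionCompat_canonical` — the same with F-0521 displayed in its surviving INSTANCE FORM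
  (`η ∈ thetaCocycles`, `hcompat` against the DERIVED `Facts`) instead of `hΘ`;
* `lem59_iv_node_ofThetaSettingYdd` — the NODE TOKEN proposed for `N_EtTh_Lem5_9_iv′`: Lemma 5.9 (iv) "is an isomorphism of mod `N`
  bi-theta environments" ∧ "In particular, … a mod `N` mono-theta environment" (abc-iut-L2-t4's `FrdIsMonoThetaEnv` = the [IUTchII]
  Prop. 1.2 (ii) binder `hM`), both canonical, modulo EXACTLY {junction data, `hconst`, `hD`, `m`, `hΘ`}.  (The second conjunct is the
  statement abc-iut-L2-t11 g7 lands as `frdIsMonoThetaEnv_ofThetaSettingYdd_of_originClause_canonical` in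
  `Discharge/Sec5Thm510iiiOfThetaSettingYdd.lean` (p462036); it is obtained here by the same one-line composition over p441744 so that this
  file imports only built modules.)
HONEST FRAMING: kernel-checked compositions over the typed junction; `tf` (a tempered Frobenioid over `B^temp(Π^tp_X̲̲)⁰`) is an abstract
parameter, not inhabited in the tree for an actual curve; the dictionary `hD` is a hypothesis; FACT rows are assumption LABELS whose universal
closures are refuted and whose instance forms are the theorems named above; nothing of [EtTh] is asserted unconditionally; no side is taken
on [IUTchIII] Cor. 3.12 or on any author; typed ≠ proved.
-/

noncomputable section

namespace Literature.AnabelianGeometry.EtaleTheta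

open CategoryTheory Opposite Literature.AlgebraicGeometry.Frobenioids Literature.AnabelianGeometry.SemiGraphs
  Literature.AnabelianGeometry.SemiGraphs.GaloisObjects Literature.AlgebraicGeometry.Frobenioids.QuasiTemperoid.BTempConnected
open scoped Pointwise

universe v₀

namespace ThetaFrobenioid

section Lem59ivNode

variable {p : ℕ} [Fact p.Prime] {D : ThetaSetting p} {E : D.EtaleThetaData} {l : ℕ} {C : E.DoubleUnderline l}
  {e : D.toTemperedCurve.GroupLevelData} {N : ℕ+} (μ : D.CyclotomeMod l N) (hC : D.Compat) (hS : D.Sec2Hyps)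
  {D₀ : Type} [Category.{v₀} D₀] {V : FrdIMonoidStub.{0}} {T₀ : RealifiedDivisorMonoids (D₀ := D₀) V}
  {VD : FrdICatStub.{1, 0, 0} (ConnectedPart (BTemp (C.temperedArithmeticGroup e).Pi))}
  {tf : TemperedFrobenioid T₀ (ConnectedPart (BTemp (C.temperedArithmeticGroup e).Pi)) VD} {hZ : tf.monoidType = MonoidType.Z}
  {hP : ∀ A : (ConnectedPart (BTemp (C.temperedArithmeticGroup e).Pi))ᵒᵖ, IsPerfect (tf.Φ.carrier A)}
  {NH : Subgroup (Field.absoluteGaloisGroup D.K) → tf.category → ℕ+ → Prop}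
  {pullFrac : ∀ {A A' : (BiKummerSetting.mkOfThetaSettingYdd C e μ hC hS tf hZ hP NH).C} (_ : A' ⟶ A),
    (BiKummerSetting.mkOfThetaSettingYdd C e μ hC hS tf hZ hP NH).biratUnits A →
      (BiKummerSetting.mkOfThetaSettingYdd C e μ hC hS tf hZ hP NH).biratUnits A'}
  {θ : (BiKummerSetting.mkOfThetaSettingYdd C e μ hC hS tf hZ hP NH).biratUnits (BiKummerSetting.mkOfThetaSettingYdd C e μ hC hS tf hZ hP NH).Aodot}
  {Bl : (BiKummerSetting.mkOfThetaSettingYdd C e μ hC hS tf hZ hP NH).C}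
  {Pl : (BiKummerSetting.mkOfThetaSettingYdd C e μ hC hS tf hZ hP NH).FractionPair θ Bl}
  {Rl : (BiKummerSetting.mkOfThetaSettingYdd C e μ hC hS tf hZ hP NH).NthRoot θ Pl C.lPNat pullFrac}
  (h : ModelFrobenioid.Hypotheses tf.divisorMonoid tf.ratFnFunctor)
  (Q : FrobenioidTheta.ThetaSubquotientStub.{0} (ConnectedPart (BTemp (C.temperedArithmeticGroup e).Pi)))
  (R : (BiKummerSetting.mkOfThetaSettingYdd C e μ hC hS tf hZ hP NH).NthRoot Rl.root Rl.pair N pullFrac)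
  (K' : Type) [Field K'] (constEmb : K'ˣ →* tf.biratUnitsModel R.BN) (constEmb_injective : Function.Injective constEmb)
  (hinvc : ∀ g : Aut R.AN.base,
    pull tf.divisorMonoid g.hom (ModelFrobenioid.div R.pair.num) = ModelFrobenioid.div R.pair.num)
  (hinvp : ∀ y : (C.thetaEnvData μ hC hS).PiX, y ∈ (C.thetaEnvData μ hC hS).PiYdd →
    pull tf.divisorMonoid ((BiKummerSetting.mkOfThetaSettingYdd C e μ hC hS tf hZ hP NH).galoisSurj
      R.AN.base R.αData.isGalois ((ContinuousMulEquiv.refl _) y)).hom (ModelFrobenioid.div R.pair.den) = ModelFrobenioid.div R.pair.den)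
  (hconst : ∀ (ε : Aut R.BN) (k : K'ˣ), tf.biratAutModel R.BN ε (constEmb k) = constEmb k)
  (m : (ofThetaSettingData μ hC hS h Q R K' constEmb constEmb_injective hinvc hinvp).muTorsion
      (ofThetaSettingData μ hC hS h Q R K' constEmb constEmb_injective hinvc hinvp).BN N ≃* (C.thetaEnvData μ hC hS).mu)
  {Cst : Subgroup ((ofThetaSettingData μ hC hS h Q R K' constEmb constEmb_injective hinvc hinvp).biratUnits
      (ofThetaSettingData μ hC hS h Q R K' constEmb constEmb_injective hinvc hinvp).BN)}
  {ν' : Cst →* (PadicAlgCl p)ˣ}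
  (hD : BiratAutAction.ConstantsDictionary
    (biratAutAction_ofConnectedTemperoidData (T := C.thetaEnvData μ hC hS) h Q C.odd_lPNat R (ContinuousMulEquiv.refl _) K' constEmb
      constEmb_injective hinvc hinvp hconst) C μ hC hS (ContinuousMulEquiv.refl _) m Cst ν')

include hD

/-- **The node's closer RE-KEYED — [EtTh] Lemma 5.9 (iv) IN FULL at the §5 data of the Setting (`A_⊙^bs := Ÿ̲̲`) with NO §5-law binder
and NO `Facts` binder displayed** (abc-iut-L2-t4's `EnvIsoBiTheta`: "the natural inclusions `μ_N(B_N) ↪ E_N`, `Im(Π^tp_Y) ⊆ E_N` determine an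
isomorphism of topological groups `E^Π_N ⥲ Π^tp_Y[μ_N]` which is an isomorphism of mod `N` bi-theta environments", for the object `E^Π_N`
indexed by the law proofs SUPPLIED BY NAME: `SectionsFactor` / `SgpCapSection` / `SgpCupSection` / `ConstantsEqNormalizer` from `Facts` ⟸
{`hconst`, `hD`} (p440765), `OuterActionLZ` from `outerActionLZ_of`), at the honest `DK`; every other binder of `envIsoBiTheta_of`
(`hY`, `hYdd`, `hχX`, `hχ`, `hK1`, `hK2`, `hcompat`) is derived inside abc-iut-L2-t11's chain p437577 → p439828 → p441744.
Residual EXACTLY: the junction data, `hconst`, `hD`, `m`, the Prop. 5.2 (iii) origin clause `hΘ`.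
[cite: MochizukiEtTh2009, Lem 5.9 (iv) p.332 (PDF p.106); Prop 5.2 (iii) p.324 (PDF p.98)] -/
theorem envIsoBiTheta_ofThetaSettingYdd_of_originClause_canonical
    (hΘ : (fun k : (C.thetaEnvData μ hC hS).PiYdd =>
        (m ((ofThetaSettingData μ hC hS h Q R K' constEmb constEmb_injective hinvc hinvp).diffCocycle
          (facts_ofThetaSettingYddData_of_constantsDictionary (hD' := hD)) k))⁻¹) ∈ C.thetaCocycles hC μ) :
    (ofThetaSettingData μ hC hS h Q R K' constEmb constEmb_injective hinvc hinvp).EnvIsoBiTheta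
      (facts_ofThetaSettingYddData_of_constantsDictionary (hD' := hD)).sectionsFactor
      (ofThetaSettingData μ hC hS h Q R K' constEmb constEmb_injective hinvc hinvp).outerActionLZ_of
      (facts_ofThetaSettingYddData_of_constantsDictionary (hD' := hD)).sgpCapSection
      (facts_ofThetaSettingYddData_of_constantsDictionary (hD' := hD)).sgpCupSection
      (facts_ofThetaSettingYddData_of_constantsDictionary (hD' := hD)).constantsEqNormalizer
      (dkOfConnectedTemperoidData (T := C.thetaEnvData μ hC hS) h Q C.odd_lPNat R (ContinuousMulEquiv.refl _) K' constEmb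
        constEmb_injective hinvc hinvp hconst
        (kxRootNModCyclotome_ofThetaSettingData_of_constantsDictionary μ hC hS h Q R K' constEmb constEmb_injective hinvc hinvp hconst m hD))
      (C.thetaEnvData μ hC hS) (ContinuousMulEquiv.refl _) :=
  envIsoBiTheta_ofThetaSettingData_of_originClause μ hC hS h Q R K' constEmb constEmb_injective hinvc hinvp hconst m hD
    (facts_ofThetaSettingYddData_of_constantsDictionary (hD' := hD)) hΘ

/-- **The same re-keyed closer with F-0521 displayed in its surviving INSTANCE FORM** — the Prop. 5.2 (iii) dictionary `hcompat` («the unit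
part of `s^⊔-Π_N(k)` read through `m` is `η(k)⁻¹`») for a cocycle `η` OF THE COLLECTION, against the DERIVED bundle `Facts` ⟸ {`hconst`, `hD`} —
instead of the origin clause: [EtTh] Lemma 5.9 (iv) in full at the Ÿ̲̲-junction data with no §5-law binder and no `Facts` binder (abc-iut-L2-t11 g4's
`envIsoBiTheta_ofThetaSettingData_of_constantsDictionary`, p441744, with the law arguments and `H` supplied BY NAME).  Residual EXACTLY: the
junction data, `hconst`, `hD`, `m`, (`η`, `hη`, `hcompat`).  [cite: MochizukiEtTh2009, Lem 5.9 (iv) p.332 (PDF p.106); Prop 5.2 (iii) p.324 (PDF p.98)] -/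
theorem envIsoBiTheta_ofThetaSettingYdd_of_thetaSectionCompat_canonical
    {η : (C.thetaEnvData μ hC hS).PiYdd → (C.thetaEnvData μ hC hS).mu} (hη : η ∈ (C.thetaEnvData μ hC hS).thetaCocycles)
    (hcompat : (ofThetaSettingData μ hC hS h Q R K' constEmb constEmb_injective hinvc hinvp).ThetaSectionCompat
      (facts_ofThetaSettingYddData_of_constantsDictionary (hD' := hD)) (C.thetaEnvData μ hC hS)
      (ContinuousMulEquiv.refl _).toMulEquiv m
      (identifiesPiYdd_ofThetaSettingData' μ hC hS h Q R K' constEmb constEmb_injective hinvc hinvp) η) :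
    (ofThetaSettingData μ hC hS h Q R K' constEmb constEmb_injective hinvc hinvp).EnvIsoBiTheta
      (facts_ofThetaSettingYddData_of_constantsDictionary (hD' := hD)).sectionsFactor
      (ofThetaSettingData μ hC hS h Q R K' constEmb constEmb_injective hinvc hinvp).outerActionLZ_of
      (facts_ofThetaSettingYddData_of_constantsDictionary (hD' := hD)).sgpCapSection
      (facts_ofThetaSettingYddData_of_constantsDictionary (hD' := hD)).sgpCupSection
      (facts_ofThetaSettingYddData_of_constantsDictionary (hD' := hD)).constantsEqNormalizer
      (dkOfConnectedTemperoidData (T := C.thetaEnvData μ hC hS) h Q C.odd_lPNat R (ContinuousMulEquiv.refl _) K' constEmb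
        constEmb_injective hinvc hinvp hconst
        (kxRootNModCyclotome_ofThetaSettingData_of_constantsDictionary μ hC hS h Q R K' constEmb constEmb_injective hinvc hinvp hconst m hD))
      (C.thetaEnvData μ hC hS) (ContinuousMulEquiv.refl _) :=
  envIsoBiTheta_ofThetaSettingData_of_constantsDictionary μ hC hS h Q R K' constEmb constEmb_injective hinvc hinvp hconst m hD
    (facts_ofThetaSettingYddData_of_constantsDictionary (hD' := hD)).sectionsFactor
    (ofThetaSettingData μ hC hS h Q R K' constEmb constEmb_injective hinvc hinvp).outerActionLZ_of
    (facts_ofThetaSettingYddData_of_constantsDictionary (hD' := hD)).sgpCapSection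
    (facts_ofThetaSettingYddData_of_constantsDictionary (hD' := hD)).sgpCupSection
    (facts_ofThetaSettingYddData_of_constantsDictionary (hD' := hD)).constantsEqNormalizer
    (facts_ofThetaSettingYddData_of_constantsDictionary (hD' := hD)) hη hcompat

/-- **NODE TOKEN for `EtTh:Lem5.9(iv)` at the Ÿ̲̲-junction data** (the re-key proposed for `N_EtTh_Lem5_9_iv′`): [EtTh] Lemma 5.9 (iv) —
"`E^Π_N ⥲ Π^tp_Y[μ_N]` … is an isomorphism of mod `N` bi-theta environments" (abc-iut-L2-t4's `EnvIsoBiTheta`) AND "In particular, omitting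
the homomorphism `s^⊓-Π_N` yields a mod `N` mono-theta environment" (abc-iut-L2-t4's `FrdIsMonoThetaEnv`, the [IUTchII] Prop. 1.2 (ii)
binder `hM`) — both for the canonically indexed object (NO §5-law binder, NO `Facts` binder), modulo EXACTLY {junction data, `hconst`, `hD`, `m`,
the Prop. 5.2 (iii) origin clause `hΘ`}.  The second conjunct is abc-iut-L2-t11's `frdIsMonoThetaEnv_ofThetaSettingData_of_originClause`
(p441744) ∘ abc-iut-L2-t4's `facts_ofThetaSettingYddData_of_constantsDictionary` (p440765) — the statement abc-iut-L2-t11 g7 names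
`frdIsMonoThetaEnv_ofThetaSettingYdd_of_originClause_canonical` (p462036).
[cite: MochizukiEtTh2009, Lem 5.9 (iv) p.332 (PDF p.106); Prop 5.2 (iii) p.324 (PDF p.98)] -/
theorem lem59_iv_node_ofThetaSettingYdd
    (hΘ : (fun k : (C.thetaEnvData μ hC hS).PiYdd =>
        (m ((ofThetaSettingData μ hC hS h Q R K' constEmb constEmb_injective hinvc hinvp).diffCocycle
          (facts_ofThetaSettingYddData_of_constantsDictionary (hD' := hD)) k))⁻¹) ∈ C.thetaCocycles hC μ) :
    (ofThetaSettingData μ hC hS h Q R K' constEmb constEmb_injective hinvc hinvp).EnvIsoBiTheta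
        (facts_ofThetaSettingYddData_of_constantsDictionary (hD' := hD)).sectionsFactor
        (ofThetaSettingData μ hC hS h Q R K' constEmb constEmb_injective hinvc hinvp).outerActionLZ_of
        (facts_ofThetaSettingYddData_of_constantsDictionary (hD' := hD)).sgpCapSection
        (facts_ofThetaSettingYddData_of_constantsDictionary (hD' := hD)).sgpCupSection
        (facts_ofThetaSettingYddData_of_constantsDictionary (hD' := hD)).constantsEqNormalizer
        (dkOfConnectedTemperoidData (T := C.thetaEnvData μ hC hS) h Q C.odd_lPNat R (ContinuousMulEquiv.refl _) K' constEmb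
          constEmb_injective hinvc hinvp hconst
          (kxRootNModCyclotome_ofThetaSettingData_of_constantsDictionary μ hC hS h Q R K' constEmb constEmb_injective hinvc hinvp hconst m hD))
        (C.thetaEnvData μ hC hS) (ContinuousMulEquiv.refl _) ∧
      (ofThetaSettingData μ hC hS h Q R K' constEmb constEmb_injective hinvc hinvp).FrdIsMonoThetaEnv
        (facts_ofThetaSettingYddData_of_constantsDictionary (hD' := hD)).sectionsFactor
        (ofThetaSettingData μ hC hS h Q R K' constEmb constEmb_injective hinvc hinvp).outerActionLZ_of
        (facts_ofThetaSettingYddData_of_constantsDictionary (hD' := hD)).sgpCapSection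
        (facts_ofThetaSettingYddData_of_constantsDictionary (hD' := hD)).sgpCupSection
        (facts_ofThetaSettingYddData_of_constantsDictionary (hD' := hD)).constantsEqNormalizer
        (dkOfConnectedTemperoidData (T := C.thetaEnvData μ hC hS) h Q C.odd_lPNat R (ContinuousMulEquiv.refl _) K' constEmb
          constEmb_injective hinvc hinvp hconst
          (kxRootNModCyclotome_ofThetaSettingData_of_constantsDictionary μ hC hS h Q R K' constEmb constEmb_injective hinvc hinvp hconst m hD))
        (C.thetaEnvData μ hC hS) :=
  ⟨envIsoBiTheta_ofThetaSettingYdd_of_originClause_canonical μ hC hS h Q R K' constEmb constEmb_injective hinvc hinvp hconst m hD hΘ,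
    frdIsMonoThetaEnv_ofThetaSettingData_of_originClause μ hC hS h Q R K' constEmb constEmb_injective hinvc hinvp hconst m hD
      (facts_ofThetaSettingYddData_of_constantsDictionary (hD' := hD)) hΘ⟩

end Lem59ivNode

end ThetaFrobenioid

end Literature.AnabelianGeometry.EtaleTheta

end
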